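import Literature.AlgebraicTopology.SingularHomology.LerayHirschMaps
import HarnessLib

/-!
# Leray–Hirsch comparison maps with classes in even degrees `0, 2, …, 2(n-1)`

D. Husemoller, *Fibre Bundles* (3rd ed. 1994), Ch. 17 §2 Thm. 2.5: for an `n`-dimensional complex
vector bundle the classes `1, a, …, aⁿ⁻¹ ∈ H⁰, H², …, H²ⁿ⁻²` of the projective bundle are the
input of Leray–Hirsch; and §1 (the case `n = 2`, classes `1, t`, is the Thom / `ℂP¹`-bundle
splitting `Hᵏ⁺²(B) ⊕ Hᵏ(B) ≅ Hᵏ⁺²(E)`). This file fixes the degree function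
`LerayHirsch.evenDeg n : Fin n → ℕ`, `j ↦ 2j`, and, for `n = 2`, unpacks the comparison map
`lhMap` of `LerayHirschMaps` into the familiar two-term form

  `(x, y) ↦ q^*x ⌣ c₀ + q^*y ⌣ c₂ : Hᵏ⁺²(B') × Hᵏ(B') → Hᵏ⁺²(E')`   (`lhMap_pair`,
  `bijective_lhMap_pair_iff`), and `x ↦ q^*x ⌣ c₀ : Hᵏ(B') → Hᵏ(E')` for `k < 2`
  (`lhMap_pair_lt`, `bijective_lhMap_lt_two_iff`),

so that concrete two-class splittings can be fed into / read off the general engine.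
Everything is proved; no named facts.

## References

* D. Husemoller, *Fibre Bundles*, GTM 20, Springer 1994, Ch. 17 §1 Thm. 1.1, §2 Thm. 2.5. [HusemollerFibreBundles1994]
-/

noncomputable section

open CategoryTheory Function Set

universe u

namespace Literature.AlgebraicTopology.SingularHomology

namespace LerayHirsch

/-- The degrees `0, 2, …, 2(n-1)` of the Leray–Hirsch classes `1, a, …, aⁿ⁻¹` of a projective
bundle of rank `n`. [cite: HusemollerFibreBundles1994, Ch. 17 §2 Thm. 2.5] -/
abbrev evenDeg (n : ℕ) : Fin n → ℕ := fun j ↦ 2 * (j : ℕ)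

variable (R : Type u) [CommRing R] {X' B' : Type u} [TopologicalSpace X'] [TopologicalSpace B'] (q : C(X', B'))

/-- Two classes `c₀ ∈ H⁰(E')`, `c₂ ∈ H²(E')` as a family indexed by `Fin 2` in degrees `evenDeg 2`.
[folklore] -/
def pairCls (c₀ : singularCohomology R R X' 0) (c₂ : singularCohomology R R X' 2) :
    (j : Fin 2) → singularCohomology R R X' (evenDeg 2 j) :=
  Fin.cons c₀ (Fin.cons c₂ finZeroElim)

/-- `pairCls c₀ c₂ 0 = c₀`. [folklore] -/
@[simp]
theorem pairCls_zero (c₀ : singularCohomology R R X' 0) (c₂ : singularCohomology R R X' 2) : pairCls R c₀ c₂ 0 = c₀ := rfl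

/-- `pairCls c₀ c₂ 1 = c₂`. [folklore] -/
@[simp]
theorem pairCls_one (c₀ : singularCohomology R R X' 0) (c₂ : singularCohomology R R X' 2) : pairCls R c₀ c₂ 1 = c₂ := rfl

/-- **The two-class comparison map in degrees `≥ 2`**: `θ(a) = q^*a₀ ⌣ c₀ + q^*a₁ ⌣ c₁` (the two
summands of `lhMap`, degrees as they come). [cite: HusemollerFibreBundles1994, Ch. 17 §1 Thm. 1.1] -/
theorem lhMap_pair (c : (j : Fin 2) → singularCohomology R R X' (evenDeg 2 j)) (k : ℕ) (a : Src R (evenDeg 2) B' (k + 2)) :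
    lhMap R (evenDeg 2) q c (k + 2) a =
      cupProduct (Nat.sub_add_cancel (show evenDeg 2 0 ≤ k + 2 from Nat.zero_le _))
          (singularCohomology.map R R q (k + 2 - evenDeg 2 0) (a ⟨0, Nat.zero_le _⟩)) (c 0) +
        cupProduct (Nat.sub_add_cancel (show evenDeg 2 1 ≤ k + 2 by change 2 * 1 ≤ k + 2; omega))
          (singularCohomology.map R R q (k + 2 - evenDeg 2 1) (a ⟨1, by change 2 * 1 ≤ k + 2; omega⟩)) (c 1) := by
  rw [lhMap_apply, Fin.sum_univ_two, dif_pos (show evenDeg 2 0 ≤ k + 2 from Nat.zero_le _),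
    dif_pos (show evenDeg 2 1 ≤ k + 2 by change 2 * 1 ≤ k + 2; omega)]

/-- **The two-class comparison map in degrees `< 2`**: `θ(a) = q^*a₀ ⌣ c₀`.
[cite: HusemollerFibreBundles1994, Ch. 17 §1 Thm. 1.1] -/
theorem lhMap_pair_lt (c : (j : Fin 2) → singularCohomology R R X' (evenDeg 2 j)) {k : ℕ} (hk : k < 2) (a : Src R (evenDeg 2) B' k) :
    lhMap R (evenDeg 2) q c k a =
      cupProduct (Nat.sub_add_cancel (show evenDeg 2 0 ≤ k from Nat.zero_le _))
        (singularCohomology.map R R q (k - evenDeg 2 0) (a ⟨0, Nat.zero_le _⟩)) (c 0) := by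
  rw [lhMap_apply, Fin.sum_univ_two, dif_pos (show evenDeg 2 0 ≤ k from Nat.zero_le _),
    dif_neg (show ¬evenDeg 2 1 ≤ k by change ¬2 * 1 ≤ k; omega), add_zero]

/-- The source in degree `k + 2` is `Hᵏ⁺²(B') × Hᵏ(B')`: the element with components `x`, `y`. [folklore] -/
def pairSrc (k : ℕ) (x : singularCohomology R R B' (k + 2)) (y : singularCohomology R R B' k) : Src R (evenDeg 2) B' (k + 2) :=
  fun j ↦ (Fin.cons (α := fun i : Fin 2 ↦ singularCohomology R R B' (k + 2 - evenDeg 2 i)) x (Fin.cons y finZeroElim)) j.1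

/-- The source in degree `k < 2` is `Hᵏ(B')`: the element with component `x`. [folklore] -/
def singleSrc (k : ℕ) (x : singularCohomology R R B' k) : Src R (evenDeg 2) B' k :=
  fun j ↦ (Fin.cons (α := fun i : Fin 2 ↦ singularCohomology R R B' (k - evenDeg 2 i)) x (Fin.cons 0 finZeroElim)) j.1

/-- `a ↦ (a₀, a₁) : Src (k+2) → Hᵏ⁺²(B') × Hᵏ(B')` is bijective. [folklore] -/
theorem pairProj_bijective (k : ℕ) :
    Bijective fun a : Src R (evenDeg 2) B' (k + 2) ↦
      ((a ⟨0, Nat.zero_le _⟩ : singularCohomology R R B' (k + 2)),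
        (a ⟨1, by change 2 * 1 ≤ k + 2; omega⟩ : singularCohomology R R B' k)) := by
  constructor
  · intro a a' h
    funext j
    obtain ⟨j, hj⟩ := j
    fin_cases j
    · exact congrArg Prod.fst h
    · exact congrArg Prod.snd h
  · rintro ⟨x, y⟩
    exact ⟨pairSrc R k x y, rfl⟩

/-- `a ↦ a₀ : Src k → Hᵏ(B')` is bijective for `k < 2`. [folklore] -/
theorem singleProj_bijective {k : ℕ} (hk : k < 2) :
    Bijective fun a : Src R (evenDeg 2) B' k ↦ (a ⟨0, Nat.zero_le _⟩ : singularCohomology R R B' k) := by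
  constructor
  · intro a a' h
    funext j
    obtain ⟨j, hj⟩ := j
    fin_cases j
    · exact h
    · exact absurd hj (by change ¬2 * 1 ≤ k; omega)
  · intro x
    exact ⟨singleSrc R k x, rfl⟩

/-- **Bijectivity of `θ` in degree `k + 2` is bijectivity of `(x, y) ↦ q^*x ⌣ c₀ + q^*y ⌣ c₁`.**
[cite: HusemollerFibreBundles1994, Ch. 17 §1 Thm. 1.1] -/
theorem bijective_lhMap_pair_iff (c : (j : Fin 2) → singularCohomology R R X' (evenDeg 2 j)) (k : ℕ) :
    Bijective (lhMap R (evenDeg 2) q c (k + 2)) ↔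
      Bijective fun x : singularCohomology R R B' (k + 2) × singularCohomology R R B' k ↦
        cupProduct (show (k + 2) + 0 = k + 2 from rfl) (singularCohomology.map R R q (k + 2) x.1) (c 0) +
          cupProduct (show k + 2 = k + 2 from rfl) (singularCohomology.map R R q k x.2) (c 1) := by
  have hcomp : (lhMap R (evenDeg 2) q c (k + 2) : Src R (evenDeg 2) B' (k + 2) → singularCohomology R R X' (k + 2)) =
      (fun x : singularCohomology R R B' (k + 2) × singularCohomology R R B' k ↦
        cupProduct (show (k + 2) + 0 = k + 2 from rfl) (singularCohomology.map R R q (k + 2) x.1) (c 0) +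
          cupProduct (show k + 2 = k + 2 from rfl) (singularCohomology.map R R q k x.2) (c 1)) ∘
      (fun a : Src R (evenDeg 2) B' (k + 2) ↦
        ((a ⟨0, Nat.zero_le _⟩ : singularCohomology R R B' (k + 2)),
          (a ⟨1, by change 2 * 1 ≤ k + 2; omega⟩ : singularCohomology R R B' k))) := by
    funext a
    rw [lhMap_pair]
    rfl
  rw [hcomp]
  exact Function.Bijective.of_comp_iff _ (pairProj_bijective R (B' := B') k)

/-- **Bijectivity of `θ` in degree `k < 2` is bijectivity of `x ↦ q^*x ⌣ c₀`.**
[cite: HusemollerFibreBundles1994, Ch. 17 §1 Thm. 1.1] -/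
theorem bijective_lhMap_lt_two_iff (c : (j : Fin 2) → singularCohomology R R X' (evenDeg 2 j)) {k : ℕ} (hk : k < 2) :
    Bijective (lhMap R (evenDeg 2) q c k) ↔
      Bijective fun x : singularCohomology R R B' k ↦
        cupProduct (show k + 0 = k from rfl) (singularCohomology.map R R q k x) (c 0) := by
  have hcomp : (lhMap R (evenDeg 2) q c k : Src R (evenDeg 2) B' k → singularCohomology R R X' k) =
      (fun x : singularCohomology R R B' k ↦ cupProduct (show k + 0 = k from rfl) (singularCohomology.map R R q k x) (c 0)) ∘
      (fun a : Src R (evenDeg 2) B' k ↦ (a ⟨0, Nat.zero_le _⟩ : singularCohomology R R B' k)) := by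
    funext a
    rw [lhMap_pair_lt R q c hk]
    rfl
  rw [hcomp]
  exact Function.Bijective.of_comp_iff _ (singleProj_bijective R (B' := B') hk)

/-! ### One class (`n = 1`) -/

/-- **The one-class comparison map**: `θ(a) = q^*a₀ ⌣ c₀`. [cite: HusemollerFibreBundles1994, Ch. 17 §1 Thm. 1.1] -/
theorem lhMap_one (c : (j : Fin 1) → singularCohomology R R X' (evenDeg 1 j)) (k : ℕ) (a : Src R (evenDeg 1) B' k) :
    lhMap R (evenDeg 1) q c k a =
      cupProduct (Nat.sub_add_cancel (show evenDeg 1 0 ≤ k from Nat.zero_le _))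
        (singularCohomology.map R R q (k - evenDeg 1 0) (a ⟨0, Nat.zero_le _⟩)) (c 0) := by
  rw [lhMap_apply, Fin.sum_univ_one, dif_pos (show evenDeg 1 0 ≤ k from Nat.zero_le _)]

/-- `a ↦ a₀ : Src k → Hᵏ(B')` is bijective (one class). [folklore] -/
theorem oneProj_bijective (k : ℕ) :
    Bijective fun a : Src R (evenDeg 1) B' k ↦ (a ⟨0, Nat.zero_le _⟩ : singularCohomology R R B' k) := by
  constructor
  · intro a a' h
    funext j
    obtain ⟨j, hj⟩ := j
    fin_cases j
    exact h
  · intro x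
    exact ⟨fun j ↦ (Fin.cons (α := fun i : Fin 1 ↦ singularCohomology R R B' (k - evenDeg 1 i)) x finZeroElim) j.1, rfl⟩

/-- **Bijectivity of the one-class `θ` is bijectivity of `x ↦ q^*x ⌣ c₀`.** [cite: HusemollerFibreBundles1994, Ch. 17 §1 Thm. 1.1] -/
theorem bijective_lhMap_one_iff (c : (j : Fin 1) → singularCohomology R R X' (evenDeg 1 j)) (k : ℕ) :
    Bijective (lhMap R (evenDeg 1) q c k) ↔
      Bijective fun x : singularCohomology R R B' k ↦
        cupProduct (show k + 0 = k from rfl) (singularCohomology.map R R q k x) (c 0) := by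
  have hcomp : (lhMap R (evenDeg 1) q c k : Src R (evenDeg 1) B' k → singularCohomology R R X' k) =
      (fun x : singularCohomology R R B' k ↦ cupProduct (show k + 0 = k from rfl) (singularCohomology.map R R q k x) (c 0)) ∘
      (fun a : Src R (evenDeg 1) B' k ↦ (a ⟨0, Nat.zero_le _⟩ : singularCohomology R R B' k)) := by
    funext a
    rw [lhMap_one]
    rfl
  rw [hcomp]
  exact Function.Bijective.of_comp_iff _ (oneProj_bijective R (B' := B') k)

/-! ### From `n` to `n + 1` classes: restriction and extension of sources -/

section Succ

variable (n : ℕ)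

/-- Forget the top component: `Src (n+1) → Src n` along `Fin.castSucc`. [folklore] -/
def restrictSrc (k : ℕ) (a : Src R (evenDeg (n + 1)) B' k) : Src R (evenDeg n) B' k :=
  fun j ↦ a ⟨Fin.castSucc j.1, j.2⟩

/-- Extend by zero at the top: `Src n → Src (n+1)`. [folklore] -/
def extendSrc (k : ℕ) (w : Src R (evenDeg n) B' k) : Src R (evenDeg (n + 1)) B' k :=
  fun j ↦ Fin.lastCases (motive := fun i : Fin (n + 1) ↦ 2 * (i : ℕ) ≤ k → singularCohomology R R B' (k - 2 * (i : ℕ)))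
    (fun _ ↦ 0) (fun i hi ↦ w ⟨i, hi⟩) j.1 j.2

/-- The element of `Src (n+1)` with top component `c` and zero elsewhere (`2n ≤ k`). [folklore] -/
def topSrc (k : ℕ) (_ : 2 * n ≤ k) (c : singularCohomology R R B' (k - 2 * n)) : Src R (evenDeg (n + 1)) B' k :=
  fun j ↦ Fin.lastCases (motive := fun i : Fin (n + 1) ↦ 2 * (i : ℕ) ≤ k → singularCohomology R R B' (k - 2 * (i : ℕ)))
    (fun _ ↦ c) (fun _ _ ↦ 0) j.1 j.2

/-- `restrictSrc` is linear: additivity. [folklore] -/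
@[simp]
theorem restrictSrc_add (k : ℕ) (a a' : Src R (evenDeg (n + 1)) B' k) :
    restrictSrc R n k (a + a') = restrictSrc R n k a + restrictSrc R n k a' := rfl

/-- `restrictSrc 0 = 0`. [folklore] -/
@[simp]
theorem restrictSrc_zero (k : ℕ) : restrictSrc R n k (0 : Src R (evenDeg (n + 1)) B' k) = 0 := rfl

/-- `restrictSrc` is linear: scalars. [folklore] -/
@[simp]
theorem restrictSrc_smul (k : ℕ) (r : R) (a : Src R (evenDeg (n + 1)) B' k) :
    restrictSrc R n k (r • a) = r • restrictSrc R n k a := rfl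

/-- `restrict ∘ extend = 𝟙`. [folklore] -/
@[simp]
theorem restrictSrc_extendSrc (k : ℕ) (w : Src R (evenDeg n) B' k) : restrictSrc R n k (extendSrc R n k w) = w := by
  funext j
  change Fin.lastCases (motive := fun i : Fin (n + 1) ↦ 2 * (i : ℕ) ≤ k → singularCohomology R R B' (k - 2 * (i : ℕ)))
    (fun _ ↦ 0) (fun i hi ↦ w ⟨i, hi⟩) (Fin.castSucc j.1) j.2 = w j
  rw [Fin.lastCases_castSucc]

/-- `restrict ∘ top = 0`. [folklore] -/
@[simp]
theorem restrictSrc_topSrc (k : ℕ) (h : 2 * n ≤ k) (c : singularCohomology R R B' (k - 2 * n)) :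
    restrictSrc R n k (topSrc R n k h c) = 0 := by
  funext j
  change Fin.lastCases (motive := fun i : Fin (n + 1) ↦ 2 * (i : ℕ) ≤ k → singularCohomology R R B' (k - 2 * (i : ℕ)))
    (fun _ ↦ c) (fun _ _ ↦ 0) (Fin.castSucc j.1) j.2 = 0
  rw [Fin.lastCases_castSucc]

/-- The top component of `extendSrc w` is `0`. [folklore] -/
@[simp]
theorem extendSrc_last (k : ℕ) (w : Src R (evenDeg n) B' k) (h : 2 * n ≤ k) : extendSrc R n k w ⟨Fin.last n, h⟩ = 0 := by
  change Fin.lastCases (motive := fun i : Fin (n + 1) ↦ 2 * (i : ℕ) ≤ k → singularCohomology R R B' (k - 2 * (i : ℕ)))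
    (fun _ ↦ 0) (fun i hi ↦ w ⟨i, hi⟩) (Fin.last n) h = 0
  rw [Fin.lastCases_last]

/-- The top component of `topSrc c` is `c`. [folklore] -/
@[simp]
theorem topSrc_last (k : ℕ) (h : 2 * n ≤ k) (c : singularCohomology R R B' (k - 2 * n)) : topSrc R n k h c ⟨Fin.last n, h⟩ = c := by
  change Fin.lastCases (motive := fun i : Fin (n + 1) ↦ 2 * (i : ℕ) ≤ k → singularCohomology R R B' (k - 2 * (i : ℕ)))
    (fun _ ↦ c) (fun _ _ ↦ 0) (Fin.last n) h = c
  rw [Fin.lastCases_last]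

/-- `extend 0 = 0`. [folklore] -/
@[simp]
theorem extendSrc_zero (k : ℕ) : extendSrc R n k (0 : Src R (evenDeg n) B' k) = 0 := by
  funext j
  obtain ⟨j, hj⟩ := j
  induction j using Fin.lastCases with
  | last =>
    change Fin.lastCases (motive := fun i : Fin (n + 1) ↦ 2 * (i : ℕ) ≤ k → singularCohomology R R B' (k - 2 * (i : ℕ)))
      (fun _ ↦ 0) (fun i hi ↦ (0 : Src R (evenDeg n) B' k) ⟨i, hi⟩) (Fin.last n) hj = 0
    rw [Fin.lastCases_last]
  | cast i =>
    change Fin.lastCases (motive := fun i : Fin (n + 1) ↦ 2 * (i : ℕ) ≤ k → singularCohomology R R B' (k - 2 * (i : ℕ)))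
      (fun _ ↦ 0) (fun i hi ↦ (0 : Src R (evenDeg n) B' k) ⟨i, hi⟩) (Fin.castSucc i) hj = 0
    rw [Fin.lastCases_castSucc]
    rfl

/-- `top 0 = 0`. [folklore] -/
@[simp]
theorem topSrc_zero (k : ℕ) (h : 2 * n ≤ k) : topSrc R n k h (0 : singularCohomology R R B' (k - 2 * n)) = 0 := by
  funext j
  obtain ⟨j, hj⟩ := j
  induction j using Fin.lastCases with
  | last =>
    change Fin.lastCases (motive := fun i : Fin (n + 1) ↦ 2 * (i : ℕ) ≤ k → singularCohomology R R B' (k - 2 * (i : ℕ)))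
      (fun _ ↦ (0 : singularCohomology R R B' (k - 2 * n))) (fun _ _ ↦ 0) (Fin.last n) hj = 0
    rw [Fin.lastCases_last]
    rfl
  | cast i =>
    change Fin.lastCases (motive := fun i : Fin (n + 1) ↦ 2 * (i : ℕ) ≤ k → singularCohomology R R B' (k - 2 * (i : ℕ)))
      (fun _ ↦ (0 : singularCohomology R R B' (k - 2 * n))) (fun _ _ ↦ 0) (Fin.castSucc i) hj = 0
    rw [Fin.lastCases_castSucc]

/-- `top` is additive in `c`… rather: `top (r • c) = r • top c`. [folklore] -/
theorem topSrc_smul (k : ℕ) (h : 2 * n ≤ k) (r : R) (c : singularCohomology R R B' (k - 2 * n)) :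
    topSrc R n k h (r • c) = r • topSrc R n k h c := by
  funext j
  obtain ⟨j, hj⟩ := j
  change topSrc R n k h (r • c) ⟨j, hj⟩ = r • topSrc R n k h c ⟨j, hj⟩
  induction j using Fin.lastCases with
  | last => rw [topSrc_last, topSrc_last]; rfl
  | cast i =>
    have e : ∀ c' : singularCohomology R R B' (k - 2 * n), topSrc R n k h c' ⟨Fin.castSucc i, hj⟩ = 0 := fun c' ↦ by
      change Fin.lastCases (motive := fun i : Fin (n + 1) ↦ 2 * (i : ℕ) ≤ k → singularCohomology R R B' (k - 2 * (i : ℕ)))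
        (fun _ ↦ c') (fun _ _ ↦ 0) (Fin.castSucc i) hj = 0
      rw [Fin.lastCases_castSucc]
    rw [e, e, smul_zero]

/-- **Decomposition of `Src (n+1)`**: `a = extend (restrict a) + top (a_last)` (when `2n ≤ k`). [folklore] -/
theorem extendSrc_restrictSrc_add_topSrc (k : ℕ) (h : 2 * n ≤ k) (a : Src R (evenDeg (n + 1)) B' k) :
    extendSrc R n k (restrictSrc R n k a) + topSrc R n k h (a ⟨Fin.last n, h⟩) = a := by
  funext j
  obtain ⟨j, hj⟩ := j
  change extendSrc R n k (restrictSrc R n k a) ⟨j, hj⟩ + topSrc R n k h (a ⟨Fin.last n, h⟩) ⟨j, hj⟩ = a ⟨j, hj⟩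
  induction j using Fin.lastCases with
  | last => rw [extendSrc_last, topSrc_last, zero_add]
  | cast i =>
    have e1 : extendSrc R n k (restrictSrc R n k a) ⟨Fin.castSucc i, hj⟩ = a ⟨Fin.castSucc i, hj⟩ := by
      change Fin.lastCases (motive := fun i : Fin (n + 1) ↦ 2 * (i : ℕ) ≤ k → singularCohomology R R B' (k - 2 * (i : ℕ)))
        (fun _ ↦ 0) (fun i hi ↦ restrictSrc R n k a ⟨i, hi⟩) (Fin.castSucc i) hj = _
      rw [Fin.lastCases_castSucc]
      rfl
    have e2 : topSrc R n k h (a ⟨Fin.last n, h⟩) ⟨Fin.castSucc i, hj⟩ = 0 := by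
      change Fin.lastCases (motive := fun i : Fin (n + 1) ↦ 2 * (i : ℕ) ≤ k → singularCohomology R R B' (k - 2 * (i : ℕ)))
        (fun _ ↦ a ⟨Fin.last n, h⟩) (fun _ _ ↦ 0) (Fin.castSucc i) hj = 0
      rw [Fin.lastCases_castSucc]
    rw [e1, e2, add_zero]

/-- **Decomposition when `2n > k`**: `a = extend (restrict a)`. [folklore] -/
theorem extendSrc_restrictSrc (k : ℕ) (h : ¬2 * n ≤ k) (a : Src R (evenDeg (n + 1)) B' k) :
    extendSrc R n k (restrictSrc R n k a) = a := by
  funext j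
  obtain ⟨j, hj⟩ := j
  induction j using Fin.lastCases with
  | last => exact absurd hj (by change ¬2 * n ≤ k; exact h)
  | cast i =>
    change Fin.lastCases (motive := fun i : Fin (n + 1) ↦ 2 * (i : ℕ) ≤ k → singularCohomology R R B' (k - 2 * (i : ℕ)))
      (fun _ ↦ 0) (fun i hi ↦ restrictSrc R n k a ⟨i, hi⟩) (Fin.castSucc i) hj = _
    rw [Fin.lastCases_castSucc]
    rfl

/-- **The comparison map with `n + 1` classes = the one with the first `n` classes on the restricted
source + the top term** `q^*a_n ⌣ c_n` (present iff `2n ≤ k`). [cite: HusemollerFibreBundles1994, Ch. 17 §1 Thm. 1.1] -/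
theorem lhMap_succ (c : (j : Fin (n + 1)) → singularCohomology R R X' (evenDeg (n + 1) j)) (k : ℕ) (a : Src R (evenDeg (n + 1)) B' k) :
    lhMap R (evenDeg (n + 1)) q c k a =
      lhMap R (evenDeg n) q (fun i ↦ c (Fin.castSucc i)) k (restrictSrc R n k a) +
        (if h : 2 * n ≤ k then cupProduct (Nat.sub_add_cancel h)
          (singularCohomology.map R R q (k - 2 * n) (a ⟨Fin.last n, h⟩)) (c (Fin.last n)) else 0) := by
  rw [lhMap_apply, lhMap_apply, Fin.sum_univ_castSucc]
  rfl

end Succ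

end LerayHirsch

end Literature.AlgebraicTopology.SingularHomology
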